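import Summits.QuantumFields.YangMills.Theorems.VirialFluxGapAnchorSliceQuadraticGrowth
import Summits.QuantumFields.YangMills.Theorems.VirialFluxGapFixSliceDefs
import Summits.QuantumFields.YangMills.Theorems.VirialFluxGapAnchorSliceCovering
import HarnessLib

/-!
# Quadratic growth of `F_fix` along the SLICE MAP `fixSlice` of the anchor chart — the coercivity input in the letters of
# ✓`VirialFluxGapFixSliceDefs` (item (a)→(d) junction of the DIRECT Laplace road to ⟨stmt-QuantumFields-24204⟩ `VirialFluxGap.SharpTwistedLaplace`)

Helper module (free-hands work of width seat ym-line-sfw-p2-w2 g50, cell ym-idea-1; `--supports 24204`).  ✓`AnchorSlice.ringDeficit_quadratic_growth_anchorSlice`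
is stated in Cor-B letters (`su2Quat P = e^{a}·su2Quat R_s`); here it is READ ALONG w3 g57's slice map
`fixSlice ωC ωN ωX C₀ N_s R y = fixSplit⁻¹((seamSlice (y.1 0), linkSlice (y.1 1) (y.1 2)), restChart R 1 y.2)` at the base ring `Q_s`
(anchors: seam site `0`, wrap link `e₀ = ((−1,−1,−1), k₀)`; `N_s = centreElem(s k₀)·N₀`; remaining components `R` = those of `Q_s`):
* §1 the coordinates of `fixSlice … y` and of the glued ring `ι(fixSlice … y)` in Cor-B letters (`fixSlice_seam`, `fixSlice_link`, `fixSlice_off`, …);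
* §2 ★★ `ringDeficit_fixSlice_quadratic_growth` — if every slice coordinate has norm `≤ 1/(10⁷L¹¹)` then
  `(y.1 0)² + ((y.1 1)² + (y.1 2)²) + Σ_i ‖y.2.1 i‖² + Σ_{j,e} ‖y.2.2.1 j e‖² + Σ_x ‖y.2.2.2 x‖² ≤ 10²²·L³³ · F_fix(fixSlice … y)`.
With the block-reading isometry `fixCoord : ℝ^{18L⁴} → ℝ³ × RestParam` (✓`VirialFluxGapFixCoordDefs`) the left side is `‖v‖²`, i.e. this is `hgrowth`
of ✓`coercive_of_quadratic_growth_decomposed` ∕ the `κ‖y‖² ≤ F(σ y)` of the assembly.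
Everything here is PROVED; no definitions, no named facts (namespace `Summit.QuantumFields.YangMills.Theorems.VirialFluxGap.AnchorSlice`).

HONEST FRAMING: bookkeeping; ⟨24204⟩, ⟨24319⟩, ⟨22884⟩ and every rung stay OPEN; the Yang–Mills mass gap (Clay) is NOT touched; no summit is proved by a line.
-/

set_option autoImplicit false

noncomputable section

open scoped Quaternion RealInnerProductSpace BigOperators
open NormedSpace Finset
open Literature.MathematicalPhysics.QuantumFieldTheory hiding SU2 su2Quat_mul
open Literature.MathematicalPhysics.QuantumLattice
open Literature.MathematicalPhysics.QuantumFieldTheory.Balaban1983to89.T4HaarSU2Translate (su2Quat_mul)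
open Literature.MathematicalPhysics.QuantumFieldTheory.Balaban1983to89.T4WilsonLinkAffine (su2Quat_inv)
open Literature.MathematicalPhysics.QuantumFieldTheory.Balaban1983to89.T4HaarSU2ExpChart
open Summit.QuantumFields.YangMills.Theorems.FemtoTransferGap
open Summit.QuantumFields.YangMills.Theorems.FemtoTransferGap.TT
open Summit.QuantumFields.YangMills.Theorems.FemtoTransferGap.TwoLattice
open Summit.QuantumFields.YangMills.Theorems.FemtoTransferGap.TwoLattice.Flat
open Summit.QuantumFields.YangMills.Theorems.ToronValleyVolume.Lojasiewicz
open Summit.QuantumFields.YangMills.Theorems.TwistEaterVolume.Quadratic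
open Summit.QuantumFields.YangMills.Theorems.VirialFluxGap.RingDeficit
open Summit.QuantumFields.YangMills.Theorems.VirialFluxGap.FixSplit
open Summit.QuantumFields.YangMills.Theorems.QuantitativeLaplace (not_treeEdge_wrap su2Quat_centreElem)

namespace Summit.QuantumFields.YangMills.Theorems.VirialFluxGap.AnchorSlice

variable {L : ℕ} [NeZero L]

/-! ## §1 Coordinates of the slice map -/

section Coord

variable (ωC ωN ωX : EuclideanSpace ℝ (Fin 3)) (C₀ Ns : SU2) {e₀ : OffIdx L} {y₀ : Site 3 L} (R : FixRest L e₀ y₀)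
  (y : EuclideanSpace ℝ (Fin 3) × RestParam L e₀ y₀)

omit [NeZero L] in
/-- The seam anchor of the slice point. [folklore] -/
theorem fixSlice_seam : (fixSlice ωC ωN ωX C₀ Ns R y).2.2 y₀ = seamSlice ωC C₀ (y.1 0) := by
  show (if h : y₀ = y₀ then seamSlice ωC C₀ (y.1 0) else (restChart R 1 y.2).2.2 ⟨y₀, h⟩) = _; simp

omit [NeZero L] in
/-- The other seam sites of the slice point. [folklore] -/
theorem fixSlice_site (x : {x : Site 3 L // ¬ x = y₀}) : (fixSlice ωC ωN ωX C₀ Ns R y).2.2 x.1 = expPoint (y.2.2.2 x) * R.2.2 x := by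
  show (if h : x.1 = y₀ then seamSlice ωC C₀ (y.1 0) else (restChart R 1 y.2).2.2 ⟨x.1, h⟩) = _
  rw [dif_neg x.2]
  show 1 * (expPoint (y.2.2.2 x) * R.2.2 x) * 1⁻¹ = _
  rw [one_mul, inv_one, mul_one]

omit [NeZero L] in
/-- The link anchor of the slice point. [folklore] -/
theorem fixSlice_link : (fixSlice ωC ωN ωX C₀ Ns R y).1 e₀ = linkSlice ωN ωX Ns (y.1 1) (y.1 2) := by
  show (if h : e₀ = e₀ then linkSlice ωN ωX Ns (y.1 1) (y.1 2) else (restChart R 1 y.2).1 ⟨e₀, h⟩) = _; simp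

omit [NeZero L] in
/-- The other off-tree links of slice `0`. [folklore] -/
theorem fixSlice_off (i : {i : OffIdx L // ¬ i = e₀}) : (fixSlice ωC ωN ωX C₀ Ns R y).1 i.1 = expPoint (y.2.1 i) * R.1 i := by
  show (if h : i.1 = e₀ then linkSlice ωN ωX Ns (y.1 1) (y.1 2) else (restChart R 1 y.2).1 ⟨i.1, h⟩) = _
  rw [dif_neg i.2]
  show 1 * (expPoint (y.2.1 i) * R.1 i) * 1⁻¹ = _
  rw [one_mul, inv_one, mul_one]

omit [NeZero L] in
/-- The full slices `1 … 2L−1` of the slice point. [folklore] -/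
theorem fixSlice_slice (j : Fin (2 * L - 1)) (e : Edge 3 L) : (fixSlice ωC ωN ωX C₀ Ns R y).2.1 j e = expPoint (y.2.2.1 j e) * R.2.1 j e := by
  show 1 * (expPoint (y.2.2.1 j e) * R.2.1 j e) * 1⁻¹ = _
  rw [one_mul, inv_one, mul_one]

end Coord

/-! ## §2 Quadratic growth along the slice map -/

/-- ★★ **Quadratic growth of `F_fix` along `fixSlice`** (✓`ringDeficit_quadratic_growth_anchorSlice` read in the letters of ✓`VirialFluxGapFixSliceDefs`):
at the base ring `Q_s` (anchors: seam site `0`, wrap link `((−1,−1,−1),k₀)`; `N_s = centreElem(s k₀)·N₀`; remaining components `R` those of `Q_s`), if every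
slice coordinate has norm `≤ 1/(10⁷L¹¹)`, then the squared `ℓ²`-norm of the coordinates is `≤ 10²²·L³³·F_fix(fixSlice … y)`.
[cite: Luscher1983, §2] [cite: GonzalezarroyoAltes1988, §2] -/
theorem ringDeficit_fixSlice_quadratic_growth (hL : 2 ≤ L) (z : Fin 3 → Bool) (hz : z ≠ fun _ => false) {k₀ : Fin 3} (hk₀ : z k₀ = true)
    {lam : Site 3 L → SU2} (hlamc : ∀ x, lam x ∈ Subgroup.center SU2) (hlam0 : lam 0 = 1)
    (hlamflip : ∀ (x : Site 3 L) (k : Fin 3), (x k = 0 ∨ x k = -1) → lam (x.shift k) = lam x * centreElem (z k))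
    (hlamstay : ∀ (x : Site 3 L) (k : Fin 3), x k ≠ 0 → x k ≠ -1 → lam (x.shift k) = lam x)
    {N₀ C₀ : SU2} (hN : (su2Quat N₀).re = 0) (hC : (su2Quat C₀).re = 0)
    (hNC : (su2Quat N₀).imI * (su2Quat C₀).imI + (su2Quat N₀).imJ * (su2Quat C₀).imJ + (su2Quat N₀).imK * (su2Quat C₀).imK = 0)
    {ωC ωN ωX : EuclideanSpace ℝ (Fin 3)} (hCω : ‖ωC‖ = 1) (hNω : ‖ωN‖ = 1) (hCN : ⟪ωC, ωN⟫ = 0) (hX : imQuat ωX = imQuat ωC * imQuat ωN)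
    (hC₀ : su2Quat C₀ = imQuat ωC) (s : Fin 3 → Bool)
    {R : FixRest L ⟨(((fun _ => (-1 : ZMod L)), k₀) : Edge 3 L), not_treeEdge_wrap hL k₀⟩ 0}
    (hR1 : ∀ i, R.1 i = combFlat (fun a => centreElem (s a) * (if z a then N₀ else 1)) i.1.1)
    (hR2 : ∀ j e, R.2.1 j e = combFlat (fun a => centreElem (s a) * (if z a then N₀ else 1)) e)
    (hR3 : ∀ x, R.2.2 x = lam x.1 * C₀)
    (y : EuclideanSpace ℝ (Fin 3) × RestParam L ⟨(((fun _ => (-1 : ZMod L)), k₀) : Edge 3 L), not_treeEdge_wrap hL k₀⟩ 0)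
    (hy0 : |y.1 0| ≤ 1 / (10 ^ 7 * (L : ℝ) ^ 11)) (hy12 : (y.1 1) ^ 2 + (y.1 2) ^ 2 ≤ (1 / (10 ^ 7 * (L : ℝ) ^ 11)) ^ 2)
    (hy1 : ∀ i, ‖y.2.1 i‖ ≤ 1 / (10 ^ 7 * (L : ℝ) ^ 11)) (hy2 : ∀ j e, ‖y.2.2.1 j e‖ ≤ 1 / (10 ^ 7 * (L : ℝ) ^ 11))
    (hy3 : ∀ x, ‖y.2.2.2 x‖ ≤ 1 / (10 ^ 7 * (L : ℝ) ^ 11)) :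
    (y.1 0) ^ 2 + ((y.1 1) ^ 2 + (y.1 2) ^ 2) + (∑ i, ‖y.2.1 i‖ ^ 2) + (∑ j, ∑ e, ‖y.2.2.1 j e‖ ^ 2) + ∑ x, ‖y.2.2.2 x‖ ^ 2 ≤
      10 ^ 22 * (L : ℝ) ^ 33 * ringDeficit L z
        ((Fin.cons (glue (fixSlice ωC ωN ωX C₀ (centreElem (s k₀) * N₀) R y).1) (fixSlice ωC ωN ωX C₀ (centreElem (s k₀) * N₀) R y).2.1 :
            Fin (2 * L - 1 + 1) → GaugeConfig 3 L SU2), (fixSlice ωC ωN ωX C₀ (centreElem (s k₀) * N₀) R y).2.2) := by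
  -- names
  obtain ⟨e₀, he₀⟩ : ∃ e₀ : OffIdx L, e₀ = ⟨(((fun _ => (-1 : ZMod L)), k₀) : Edge 3 L), not_treeEdge_wrap hL k₀⟩ := ⟨_, rfl⟩
  subst he₀
  obtain ⟨W, hW⟩ : ∃ W : GaugeConfig 3 L SU2, W = combFlat (fun a => centreElem (s a) * (if z a then N₀ else 1)) := ⟨_, rfl⟩
  simp_rw [← hW] at hR1 hR2
  obtain ⟨X, hXdef⟩ : ∃ X, X = fixSlice ωC ωN ωX C₀ (centreElem (s k₀) * N₀) R y := ⟨_, rfl⟩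
  rw [← hXdef]
  -- the frame
  have hC0 : (imQuat ωC).re = 0 := imQuat_re ωC
  have hN0 : (imQuat ωN).re = 0 := imQuat_re ωN
  have hX1 : ‖ωX‖ = 1 := by rw [← norm_imQuat, hX, norm_mul, norm_imQuat, norm_imQuat, hCω, hNω, mul_one]
  have hNX : ⟪ωN, ωX⟫ = 0 := by
    rw [← inner_imQuat_imQuat, hX, real_inner_comm]; exact inner_pure_mul_right hC0 hN0
  have hCX : ⟪ωC, ωX⟫ = 0 := by
    rw [← inner_imQuat_imQuat, hX, real_inner_comm]; exact inner_pure_mul_left hC0 hN0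
  have hlinknorm : ‖(y.1 1) • ωN + (y.1 2) • ωX‖ ^ 2 = (y.1 1) ^ 2 + (y.1 2) ^ 2 := by
    rw [← real_inner_self_eq_norm_sq, inner_add_left, inner_add_right, inner_add_right, real_inner_smul_left, real_inner_smul_left,
      real_inner_smul_left, real_inner_smul_left, real_inner_smul_right, real_inner_smul_right, real_inner_smul_right, real_inner_smul_right,
      real_inner_self_eq_norm_sq, real_inner_self_eq_norm_sq, hNω, hX1, hNX, real_inner_comm ωN ωX, hNX]
    ring
  -- Cor-B letters
  obtain ⟨a0, ha0def⟩ : ∃ a0 : Edge 3 L → ℍ, a0 = fun e => if he : treeEdge e = true then 0 else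
      (if hi : (⟨e, he⟩ : OffIdx L) = ⟨(((fun _ => (-1 : ZMod L)), k₀) : Edge 3 L), not_treeEdge_wrap hL k₀⟩ then imQuat ((y.1 1) • ωN + (y.1 2) • ωX)
        else imQuat (y.2.1 ⟨⟨e, he⟩, hi⟩)) := ⟨_, rfl⟩
  obtain ⟨a, hadef⟩ : ∃ a : Fin (2 * L - 1 + 1) → Edge 3 L → ℍ, a = Fin.cons a0 (fun j e => imQuat (y.2.2.1 j e)) := ⟨_, rfl⟩
  obtain ⟨b, hbdef⟩ : ∃ b : Site 3 L → ℍ, b = fun x => if hx : x = 0 then imQuat ((y.1 0) • ωC) else imQuat (y.2.2.2 ⟨x, hx⟩) := ⟨_, rfl⟩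
  have m0pos : 0 ≤ 1 / (10 ^ 7 * (L : ℝ) ^ 11) := by positivity
  -- evaluation of the letters
  have ha_tree : ∀ e : Edge 3 L, treeEdge e = true → a 0 e = 0 := fun e he => by
    rw [hadef, Fin.cons_zero, ha0def]; simp only [he, dif_pos]
  have ha_link : a 0 (((fun _ => (-1 : ZMod L)), k₀) : Edge 3 L) = imQuat ((y.1 1) • ωN + (y.1 2) • ωX) := by
    rw [hadef, Fin.cons_zero, ha0def]
    dsimp only
    rw [dif_neg (not_treeEdge_wrap hL k₀), dif_pos rfl]
  have ha_off : ∀ i : {i : OffIdx L // ¬ i = ⟨(((fun _ => (-1 : ZMod L)), k₀) : Edge 3 L), not_treeEdge_wrap hL k₀⟩},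
      a 0 i.1.1 = imQuat (y.2.1 i) := fun i => by
    rw [hadef, Fin.cons_zero, ha0def]
    dsimp only
    rw [dif_neg i.1.2, dif_neg (show ¬ (⟨i.1.1, i.1.2⟩ : OffIdx L) = _ from i.2)]
  have ha_succ : ∀ (j : Fin (2 * L - 1)) (e : Edge 3 L), a j.succ e = imQuat (y.2.2.1 j e) := fun j e => by
    rw [hadef, Fin.cons_succ]
  have hb_zero : b 0 = imQuat ((y.1 0) • ωC) := by rw [hbdef]; simp
  have hb_site : ∀ x : {x : Site 3 L // ¬ x = 0}, b x.1 = imQuat (y.2.2.2 x) := fun x => by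
    rw [hbdef]; simp only [x.2, dif_neg, not_false_eq_true, Subtype.coe_eta]
  -- the chart identities
  have hWe₀ : W (((fun _ => (-1 : ZMod L)), k₀) : Edge 3 L) = centreElem (s k₀) * N₀ := by
    rw [hW, combFlat_apply, if_pos (show ((fun _ => (-1 : ZMod L)) : Site 3 L) k₀ = -1 from rfl)]
    show centreElem (s k₀) * (if z k₀ then N₀ else 1) = centreElem (s k₀) * N₀
    rw [if_pos hk₀]
  have hP1 : ∀ i e, su2Quat ((Fin.cons (glue X.1) X.2.1 : Fin (2 * L - 1 + 1) → GaugeConfig 3 L SU2) i e) = exp (a i e) * su2Quat (W e) := by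
    intro i e
    refine Fin.cases ?_ (fun j => ?_) i
    · rw [Fin.cons_zero]
      by_cases he : treeEdge e = true
      · rw [glue_apply_of_tree _ he, ha_tree e he, hW, combFlat_apply_of_tree _ he, FemtoTransferGap.su2Quat_one, NormedSpace.exp_zero, one_mul]
      · rw [glue_apply_of_not_tree _ he]
        by_cases hi : (⟨e, he⟩ : OffIdx L) = ⟨(((fun _ => (-1 : ZMod L)), k₀) : Edge 3 L), not_treeEdge_wrap hL k₀⟩
        · have hee : e = (((fun _ => (-1 : ZMod L)), k₀) : Edge 3 L) := congrArg Subtype.val hi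
          rw [hi, hXdef, fixSlice_link, hee, ha_link, hWe₀]
          show su2Quat (expPoint ((y.1 1) • ωN + (y.1 2) • ωX) * (centreElem (s k₀) * N₀)) = _
          rw [su2Quat_mul, su2Quat_expPoint]
        · have h := fixSlice_off ωC ωN ωX C₀ (centreElem (s k₀) * N₀) R y ⟨⟨e, he⟩, hi⟩
          rw [hXdef, h, hR1, ha_off ⟨⟨e, he⟩, hi⟩, su2Quat_mul, su2Quat_expPoint]
    · rw [Fin.cons_succ, hXdef, fixSlice_slice, hR2, ha_succ, su2Quat_mul, su2Quat_expPoint]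
  have hP2 : ∀ x, su2Quat (X.2.2 x) = exp (b x) * su2Quat (lam x * C₀) := by
    intro x
    by_cases hx : x = 0
    · subst hx
      rw [hXdef, fixSlice_seam, hb_zero, hlam0, one_mul]
      show su2Quat (expPoint ((y.1 0) • ωC) * C₀) = _
      rw [su2Quat_mul, su2Quat_expPoint]
    · have h := fixSlice_site ωC ωN ωX C₀ (centreElem (s k₀) * N₀) R y ⟨x, hx⟩
      rw [hXdef, h, hR3, hb_site ⟨x, hx⟩, su2Quat_mul, su2Quat_expPoint]
  -- the slice conditions
  have hb0 : b 0 = (y.1 0) • su2Quat C₀ := by rw [hb_zero, map_smul, hC₀]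
  have hainner : ⟪a 0 (((fun _ => (-1 : ZMod L)), k₀) : Edge 3 L), su2Quat C₀⟫ = 0 := by
    rw [ha_link, hC₀, inner_imQuat_imQuat, inner_add_left, real_inner_smul_left, real_inner_smul_left, real_inner_comm ωC ωN, hCN,
      real_inner_comm ωC ωX, hCX, mul_zero, mul_zero, add_zero]
  -- smallness
  have hasmall : ∀ i e, ‖a i e‖ ≤ 1 / (10 ^ 7 * (L : ℝ) ^ 11) := by
    intro i e
    refine Fin.cases ?_ (fun j => ?_) i
    · by_cases he : treeEdge e = true
      · rw [ha_tree e he, norm_zero]; exact m0pos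
      · by_cases hi : (⟨e, he⟩ : OffIdx L) = ⟨(((fun _ => (-1 : ZMod L)), k₀) : Edge 3 L), not_treeEdge_wrap hL k₀⟩
        · have hee : e = (((fun _ => (-1 : ZMod L)), k₀) : Edge 3 L) := congrArg Subtype.val hi
          rw [hee, ha_link, norm_imQuat]
          exact (pow_le_pow_iff_left₀ (norm_nonneg _) m0pos two_ne_zero).mp (by rw [hlinknorm]; exact hy12)
        · rw [ha_off ⟨⟨e, he⟩, hi⟩, norm_imQuat]; exact hy1 _
    · rw [ha_succ, norm_imQuat]; exact hy2 j e
  have hbsmall : ∀ x, ‖b x‖ ≤ 1 / (10 ^ 7 * (L : ℝ) ^ 11) := by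
    intro x
    by_cases hx : x = 0
    · subst hx; rw [hb_zero, norm_imQuat, norm_smul, hCω, mul_one, Real.norm_eq_abs]; exact hy0
    · rw [hb_site ⟨x, hx⟩, norm_imQuat]; exact hy3 _
  -- the ring-level growth theorem
  have hP1' : ∀ i e, su2Quat ((((Fin.cons (glue X.1) X.2.1 : Fin (2 * L - 1 + 1) → GaugeConfig 3 L SU2), X.2.2) :
      (Fin (2 * L - 1 + 1) → GaugeConfig 3 L SU2) × (Site 3 L → SU2)).1 i e) =
      exp (a i e) * su2Quat (combFlat (fun a => centreElem (s a) * (if z a then N₀ else 1)) e) := fun i e => by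
    rw [← hW]; exact hP1 i e
  have hgrowth := ringDeficit_quadratic_growth_anchorSlice hL z hz hk₀ hlamc hlam0 hlamflip hlamstay hN hC hNC s ha_tree hb0 hainner hasmall
    hbsmall (P := ((Fin.cons (glue X.1) X.2.1 : Fin (2 * L - 1 + 1) → GaugeConfig 3 L SU2), X.2.2)) hP1' hP2
  -- the coordinate sum is the letter sum
  have hsumA0 : ∑ e : Edge 3 L, ‖a 0 e‖ ^ 2 = ((y.1 1) ^ 2 + (y.1 2) ^ 2) + ∑ i, ‖y.2.1 i‖ ^ 2 := by
    have h1 : ∑ e ∈ Finset.univ.filter (fun e : Edge 3 L => treeEdge e = true), ‖a 0 e‖ ^ 2 = 0 :=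
      Finset.sum_eq_zero fun e he => by rw [Finset.mem_filter] at he; rw [ha_tree e he.2, norm_zero]; ring
    have h2 : ∑ e ∈ Finset.univ.filter (fun e : Edge 3 L => ¬ treeEdge e = true), ‖a 0 e‖ ^ 2 = ∑ i : OffIdx L, ‖a 0 i.1‖ ^ 2 :=
      Finset.sum_subtype (p := fun e : Edge 3 L => ¬ treeEdge e = true) _ (fun e => by rw [Finset.mem_filter]; simp) (fun e => ‖a 0 e‖ ^ 2)
    have h3 : ∑ i ∈ Finset.univ.erase (⟨(((fun _ => (-1 : ZMod L)), k₀) : Edge 3 L), not_treeEdge_wrap hL k₀⟩ : OffIdx L), ‖a 0 i.1‖ ^ 2 =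
        ∑ i : {i : OffIdx L // ¬ i = ⟨(((fun _ => (-1 : ZMod L)), k₀) : Edge 3 L), not_treeEdge_wrap hL k₀⟩}, ‖a 0 i.1.1‖ ^ 2 :=
      Finset.sum_subtype (p := fun i : OffIdx L => ¬ i = ⟨(((fun _ => (-1 : ZMod L)), k₀) : Edge 3 L), not_treeEdge_wrap hL k₀⟩) _
        (fun i => by rw [Finset.mem_erase]; simp) (fun i : OffIdx L => ‖a 0 i.1‖ ^ 2)
    have h4 : ∑ i : {i : OffIdx L // ¬ i = ⟨(((fun _ => (-1 : ZMod L)), k₀) : Edge 3 L), not_treeEdge_wrap hL k₀⟩}, ‖a 0 i.1.1‖ ^ 2 =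
        ∑ i, ‖y.2.1 i‖ ^ 2 := Finset.sum_congr rfl fun i _ => by rw [ha_off i, norm_imQuat]
    have h5 : ‖a 0 (((fun _ => (-1 : ZMod L)), k₀) : Edge 3 L)‖ ^ 2 = (y.1 1) ^ 2 + (y.1 2) ^ 2 := by rw [ha_link, norm_imQuat, hlinknorm]
    rw [← Finset.sum_filter_add_sum_filter_not Finset.univ (fun e : Edge 3 L => treeEdge e = true) (fun e => ‖a 0 e‖ ^ 2), h1, zero_add, h2,
      ← Finset.add_sum_erase Finset.univ (fun i : OffIdx L => ‖a 0 i.1‖ ^ 2)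
        (Finset.mem_univ (⟨(((fun _ => (-1 : ZMod L)), k₀) : Edge 3 L), not_treeEdge_wrap hL k₀⟩ : OffIdx L)), h3, h4]
    exact congrArg (· + _) h5
  have hsumA1 : ∀ j : Fin (2 * L - 1), ∑ e, ‖a j.succ e‖ ^ 2 = ∑ e, ‖y.2.2.1 j e‖ ^ 2 := fun j =>
    Finset.sum_congr rfl fun e _ => by rw [ha_succ, norm_imQuat]
  have hsumA : ∑ i, ∑ e, ‖a i e‖ ^ 2 = ((y.1 1) ^ 2 + (y.1 2) ^ 2) + (∑ i, ‖y.2.1 i‖ ^ 2) + ∑ j, ∑ e, ‖y.2.2.1 j e‖ ^ 2 := by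
    rw [Fin.sum_univ_succ, hsumA0]
    simp only [hsumA1]
  have hsumB : ∑ x, ‖b x‖ ^ 2 = (y.1 0) ^ 2 + ∑ x, ‖y.2.2.2 x‖ ^ 2 := by
    have h3 : ∑ x ∈ Finset.univ.erase (0 : Site 3 L), ‖b x‖ ^ 2 = ∑ x : {x : Site 3 L // ¬ x = 0}, ‖b x.1‖ ^ 2 :=
      Finset.sum_subtype (p := fun x : Site 3 L => ¬ x = 0) _ (fun x => by rw [Finset.mem_erase]; simp) (fun x : Site 3 L => ‖b x‖ ^ 2)
    have h4 : ∑ x : {x : Site 3 L // ¬ x = 0}, ‖b x.1‖ ^ 2 = ∑ x, ‖y.2.2.2 x‖ ^ 2 := Finset.sum_congr rfl fun x _ => by rw [hb_site x, norm_imQuat]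
    have h5 : ‖b 0‖ ^ 2 = (y.1 0) ^ 2 := by rw [hb_zero, norm_imQuat, norm_smul, hCω, mul_one, Real.norm_eq_abs, sq_abs]
    rw [← Finset.add_sum_erase Finset.univ (fun x : Site 3 L => ‖b x‖ ^ 2) (Finset.mem_univ (0 : Site 3 L)), h3, h4, h5]
  rw [hsumA, hsumB] at hgrowth
  linarith

end Summit.QuantumFields.YangMills.Theorems.VirialFluxGap.AnchorSlice
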